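import Mathlib

/-!
# Tier4/Line2/BranchCoefficients — the coefficient-ring structure of LINE L2 (gate-landed twin of the skeleton block)

Blind re-derivation cell `pub-hodge-repro`, Tier 4 (README §9–§10), LINE L2 (t4-plan-2's skeleton
`Tier4/Line2/Skeleton.lean` v0.8, sha256 `fdd5978f…`, lines 192–234), landed by seat t4-L2-p1 so that the kernel
lemmas K1a / K1b / K1c / `hasEval_torsionPt` can be stated VERBATIM in gate-landed modules (the skeleton itself never
goes through the gate).  Content BYTE-IDENTICAL to the skeleton block (structure `BranchCoefficients`, its instance
attributes, `BranchCoefficients.algebraMapField_injective`, `BranchCoefficients.IsTorsionPt`); nothing is added,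
nothing is asserted.  Imports Mathlib only (`𝓞_ℂ_[p]` is Mathlib's `PadicComplexInt`).
-/

namespace Summit.Ventures.HodgeRepro.Tier4.Line2


/-- **The coefficient ring of the Katz measures**: `p` the interpolation prime (odd, every prime of `E′⁺` above `p`
split in `E′` — (ord) — `p ∤ D_{E′⁺}`, `p` prime to the tame conductors; Chebotarev gives one), `A = O` the ring of
integers of a finite extension of `ℚ_p` containing the values of the four branch characters and of the weight
characters `ψ_j` (a complete DVR, `𝔪`-adically complete, with its `𝔪`-adic topology), embedded in `𝓞_{ℂ_p}` =
Mathlib's `𝓞_ℂ_[p]` (the value domain of the Weierstrass argument, Tier3PadicComplexInt: complete, linearly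
topologised, a domain) — exactly the instance bundle of the landed `Tier3Weierstrass`. -/
structure BranchCoefficients where
  /-- the interpolation prime -/
  p : ℕ
  [hp : Fact p.Prime]
  /-- the coefficient ring `O` -/
  A : Type
  [commRing : CommRing A]
  [isDomain : IsDomain A]
  [dvr : IsDiscreteValuationRing A]
  [adicComplete : IsAdicComplete (IsLocalRing.maximalIdeal A) A]
  [uniformSpace : UniformSpace A]
  [uniformAddGroup : IsUniformAddGroup A]
  [topologicalRing : IsTopologicalRing A]
  [algebra : Algebra A 𝓞_ℂ_[p]]
  [continuousSMul : ContinuousSMul A 𝓞_ℂ_[p]]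
  /-- `O ↪ 𝓞_{ℂ_p}` -/
  algebraMap_injective : Function.Injective (algebraMap A 𝓞_ℂ_[p])
  /-- `O → ℂ_p` (the field, the value domain of Hsieh's Prop 4.9 as typed by t4-lit-4), compatible with `O → 𝓞_{ℂ_p} → ℂ_p` -/
  [algebraField : Algebra A ℂ_[p]]
  [scalarTower : IsScalarTower A 𝓞_ℂ_[p] ℂ_[p]]

attribute [instance] BranchCoefficients.hp BranchCoefficients.commRing BranchCoefficients.isDomain
  BranchCoefficients.dvr BranchCoefficients.adicComplete BranchCoefficients.uniformSpace
  BranchCoefficients.uniformAddGroup BranchCoefficients.topologicalRing BranchCoefficients.algebra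
  BranchCoefficients.continuousSMul BranchCoefficients.algebraField BranchCoefficients.scalarTower

/-- `O ↪ ℂ_p` (PROVED: the tower `O → 𝓞_{ℂ_p} → ℂ_p` of injections). -/
theorem BranchCoefficients.algebraMapField_injective (O : BranchCoefficients) :
    Function.Injective (algebraMap O.A ℂ_[O.p]) := by
  rw [IsScalarTower.algebraMap_eq O.A 𝓞_ℂ_[O.p] ℂ_[O.p]]
  exact (FaithfulSMul.algebraMap_injective 𝓞_ℂ_[O.p] ℂ_[O.p]).comp O.algebraMap_injective

/-- A torsion point of `(𝓞_{ℂ_p})^d`: every coordinate is a `p`-power root of unity. -/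
def BranchCoefficients.IsTorsionPt (O : BranchCoefficients) {d : ℕ} (η : Fin d → 𝓞_ℂ_[O.p]) : Prop :=
  ∀ i, ∃ n : ℕ, η i ^ O.p ^ n = 1


end Summit.Ventures.HodgeRepro.Tier4.Line2
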